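import Literature.AnabelianGeometry.SemiGraphs.TemperedCyclotomic
import Literature.AnabelianGeometry.EtaleTheta.SettingModelChiThetaCuspOncePunctured
import Literature.AnabelianGeometry.EtaleTheta.SettingModelChiLevelKernels
import HarnessLib

/-!
# The L3 bridge datum of the χ-twisted cusped model `modelχ′` and the Heisenberg LEVEL COORDINATES on its
# `Δ^ell_X`: `X_N, Y_N : Δ^ell_X → ℤ/N`, compatible, jointly injective, with `Y_N (g · x) = χ_N(g) · Y_N x`
# (file 2a of row «P12-PACKAGE@χ-BRIDGE»; proof-only)

S. Mochizuki, *The étale theta function and its Frobenioid-theoretic manifestations*, Publ. RIMS **45** (2009)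
[EtTh], §1, PRIMS PDF p. 12 (printed p. 238): «`Δ^ell_X := Δ^ab_X = Δ_X/[Δ_X, Δ_X]` … `1 → Ẑ(1) → Δ^ell_X → Ẑ → 1`
… Thus, `(Δ^tp_Y)^ell ≅ Ẑ(1)`» [cite: MochizukiEtTh2009, §1 p.12].

Cell abc-iut, layer L2, seat abc-iut-L2-t7 (gen 4), row «P12-PACKAGE@χ-BRIDGE» (abc-iut-L2-lead R325), file 2a
of 2.  PROOF-ONLY (0 definitions).  For the L3 bridge datum (abc-iut-L2-t7 gen 0, `SettingBridge`)
`D₀ := (ThetaSetting.modelχ′ p).toOncePuncturedTemperedGroup e` of abc-iut-w5-d029's cusped χ-TWISTED model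
(`Π^tp_X = Γ ⋊_χ G_{ℚ_p}`, `Π_X = F̂₂ ⋊_χ G_{ℚ_p}`), ANY parameter bundle `e`:

* §1 bookkeeping (`rfl` / landed identities): `Π`, `toHat`, `Δ̂ = Ker(Π_X → G_{ℚ_p}) = F̂₂ ⋊ 1`
  (`mem_bridgeχ'_deltaHat_iff`), `Δ` (`right = 1`), `Π^tp_Y` (`pr₂ g.left = 1`), `aug g = ι(g.right)`,
  `[Δ̂,Δ̂]⁻ = [Δ_X,Δ_X]⁻` of the model (`ellKerHat_bridgeχ'`);
* §2 **`exists_levels_bridgeχ'`** — the `x`- and `y`-COORDINATES of abc-iut-L2-t1/w5-d024's level maps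
  `ĥ_N : F̂₂ → Heis(ℤ/N)` DESCEND to continuous homomorphisms `X_N, Y_N : Δ^ell_X → ℤ/N` (they kill `[Δ̂,Δ̂]⁻`,
  abc-iut-L2-d1's `mem_closure_commutator₂_iff_forall_hHat`), characterised by their values on classes; then, from
  these formulas alone: compatibility in `N` (`levelY_compat`, `map_hHat_of_dvd`); **`levelY_conj`**:
  `Y_N (g · x) = χ_N(g.right) · Y_N x` (conjugation by `ĝ = (γ, σ)` acts on `left` as `Inn(γ) ∘ θ_{χ(σ)}` and
  abc-iut-w5-d024's `hHat_twist` says `θ` multiplies `y` by `χ_N`) and `levelX_conj` (`x` untwisted);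
  `levelX_eq_one_of_mem_piY` (the `x`-levels VANISH on the image of `Δ^tp_Y`: fibre-product law `ê = ι ∘ pr₂`);
  `levelY_b` (the class of `b ∈ Δ^tp_Y` has `y`-level `1`); `eq_one_of_levels_eq_one` (joint injectivity).
File 2b (`SettingModelChiCyclotomicPackage`) turns these into the Tate twist «`(Δ^tp_Y)^ell ≅ Ẑ(1)`».

HONEST LABEL: `modelχ′` is a SEMI-SYNTHETIC model (consistency evidence only, not the tempered `π₁` of a curve);
nothing of [EtTh] is asserted; no side taken on [IUTchIII] Cor. 3.12; typed ≠ proved.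
-/

noncomputable section

namespace Literature.AnabelianGeometry.EtaleTheta.SettingModel

open Literature.AnabelianGeometry.SemiGraphs _root_.Topology
open OncePuncturedTemperedGroup (galApply)

variable (p : ℕ) [Fact p.Prime]

/-! ## §1. The bridge datum of `modelχ′` -/

/-- `Π` of the bridge datum is `Γ ⋊_χ G_{ℚ_p}`. [cite: MochizukiEtTh2009, §1 p.12] -/
theorem bridgeχ'_pi (e : (ThetaSetting.modelχ' p).OncePuncturedData) :
    ((ThetaSetting.modelχ' p).toOncePuncturedTemperedGroup e).Pi = PiTpχ p := rfl

/-- `Π̂` of the bridge datum is `F̂₂ ⋊_χ G_{ℚ_p}` and `toHat` is the model's. [cite: MochizukiEtTh2009, §1 p.12] -/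
theorem bridgeχ'_toHat (e : (ThetaSetting.modelχ' p).OncePuncturedData) :
    ((ThetaSetting.modelχ' p).toOncePuncturedTemperedGroup e).toHat = toHatχ p := rfl

/-- `Δ̂` of the bridge datum is the model's `Δ_X = Ker(Π̂ → G_{ℚ_p}) = F̂₂ ⋊ 1`. [cite: MochizukiEtTh2009, §1 p.12] -/
theorem bridgeχ'_deltaHat (e : (ThetaSetting.modelχ' p).OncePuncturedData) :
    ((ThetaSetting.modelχ' p).toOncePuncturedTemperedGroup e).deltaHat =
      (SemidirectProduct.rightHom : PiHtχ p →* GQp p).ker := by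
  rw [ThetaSetting.toOncePuncturedTemperedGroup_deltaHat]
  exact deltaHatχ_eq p

/-- Membership in `Δ̂` of the bridge datum: `right = 1`. [cite: MochizukiEtTh2009, §1 p.12] -/
theorem mem_bridgeχ'_deltaHat_iff (e : (ThetaSetting.modelχ' p).OncePuncturedData) (n : PiHtχ p) :
    n ∈ ((ThetaSetting.modelχ' p).toOncePuncturedTemperedGroup e).deltaHat ↔ n.right = 1 := by
  rw [bridgeχ'_deltaHat]
  exact Iff.rfl

/-- `Δ` of the bridge datum is `Δ^tp_X`: `right = 1`. [cite: MochizukiEtTh2009, §1 p.12] -/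
theorem mem_bridgeχ'_delta_iff (e : (ThetaSetting.modelχ' p).OncePuncturedData) (g : PiTpχ p) :
    g ∈ ((ThetaSetting.modelχ' p).toOncePuncturedTemperedGroup e).delta ↔ g.right = 1 := by
  rw [ThetaSetting.toOncePuncturedTemperedGroup_delta]
  exact mem_deltaTempχ_iff p g

/-- `Π^tp_Y` of the bridge datum: `pr₂ g.left = 1`. [cite: MochizukiEtTh2009, §1 p.12] -/
theorem mem_bridgeχ'_piY_iff (e : (ThetaSetting.modelχ' p).OncePuncturedData) (g : PiTpχ p) :
    g ∈ ((ThetaSetting.modelχ' p).toOncePuncturedTemperedGroup e).piY ↔ gfpSnd g.left = 1 := by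
  change (ThetaSetting.modelχ' p).toZ g = 1 ↔ _
  rw [toZ_modelχ'_apply]

/-- The augmentation of the bridge datum is `ι ∘ (g ↦ g.right)` for the bundle's identification `ι`.
[cite: MochizukiEtTh2009, §1 p.12] -/
theorem bridgeχ'_aug (e : (ThetaSetting.modelχ' p).OncePuncturedData) (g : PiTpχ p) :
    ((ThetaSetting.modelχ' p).toOncePuncturedTemperedGroup e).aug g = e.galEquiv ((curveχ' p).augGK g) := rfl


/-- `[Δ̂, Δ̂]⁻` of the bridge datum is the model's `[Δ_X, Δ_X]⁻`. [cite: MochizukiEtTh2009, §1 p.12] -/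
theorem ellKerHat_bridgeχ' (e : (ThetaSetting.modelχ' p).OncePuncturedData) :
    ((ThetaSetting.modelχ' p).toOncePuncturedTemperedGroup e).ellKerHat =
      (⁅(curveχ p).DeltaHat, (curveχ p).DeltaHat⁆).topologicalClosure := by
  unfold OncePuncturedTemperedGroup.ellKerHat
  rw [ThetaSetting.toOncePuncturedTemperedGroup_deltaHat]
  rfl

/-! ## §2. The Heisenberg `x`/`y`-coordinates on `Δ^ell_X` of the bridge datum -/

/-- Conjugating an element of `Δ̂ = F̂₂ ⋊ 1` by `ĝ = (γ, σ) ∈ Π̂`: the `left` component is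
`γ · θ_{χ(σ)}(w) · γ⁻¹`. [cite: MochizukiEtTh2009, §1 p.12] -/
theorem left_conj_of_right_eq_one_hat (g n : PiHtχ p) (hn : n.right = 1) :
    (g * n * g⁻¹).left = g.left * actHatχ p g.right n.left * g.left⁻¹ := by
  simp only [SemidirectProduct.mul_left, SemidirectProduct.mul_right, SemidirectProduct.inv_left, hn, mul_one,
    map_inv, MulAut.apply_inv_self]

/-- **The level coordinates descend to `Δ^ell_X`.**  For the bridge datum of `modelχ′` there are continuous
homomorphisms `X_N, Y_N : Δ^ell_X → ℤ/N` (`N ≥ 1`) with `X_N [n] = x(ĥ_N n.left)`, `Y_N [n] = y(ĥ_N n.left)` on the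
class of every `n ∈ Δ̂ = F̂₂ ⋊ 1` — the `x`- and `y`-coordinates of abc-iut-L2-t1/w5-d024's `ĥ_N : F̂₂ → Heis(ℤ/N)`
kill `[Δ̂, Δ̂]⁻` (abc-iut-L2-d1's `mem_closure_commutator₂_iff_forall_hHat`). [cite: MochizukiEtTh2009, §1 p.12] -/
theorem exists_levels_bridgeχ' (e : (ThetaSetting.modelχ' p).OncePuncturedData) :
    ∃ X Y : ∀ N : ℕ+, ((ThetaSetting.modelχ' p).toOncePuncturedTemperedGroup e).DeltaEll →* Multiplicative (ZMod N),
      (∀ N, Continuous (X N)) ∧ (∀ N, Continuous (Y N)) ∧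
      (∀ (N : ℕ+) (n : PiHtχ p) (hn : n ∈ ((ThetaSetting.modelχ' p).toOncePuncturedTemperedGroup e).deltaHat),
        X N (QuotientGroup.mk ⟨n, hn⟩) = Multiplicative.ofAdd (hHat N n.left).x) ∧
      (∀ (N : ℕ+) (n : PiHtχ p) (hn : n ∈ ((ThetaSetting.modelχ' p).toOncePuncturedTemperedGroup e).deltaHat),
        Y N (QuotientGroup.mk ⟨n, hn⟩) = Multiplicative.ofAdd (hHat N n.left).y) := by
  -- the inclusion `Δ̂ → F̂₂ ⋊_χ G_{ℚ_p}` with its target spelled as the semidirect product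
  let v : ↥((ThetaSetting.modelχ' p).toOncePuncturedTemperedGroup e).deltaHat → PiHtχ p := fun n => n.1
  have hv_mul : ∀ a b, v (a * b) = v a * v b := fun _ _ => rfl
  have hv_one : v 1 = 1 := rfl
  have hright : ∀ n, (v n).right = 1 := fun n => (mem_bridgeχ'_deltaHat_iff p e _).mp n.2
  -- the coordinate homomorphisms on `Δ̂`
  let X₀ : ∀ N : ℕ+, ↥((ThetaSetting.modelχ' p).toOncePuncturedTemperedGroup e).deltaHat →* Multiplicative (ZMod N) :=
    fun N =>
      { toFun := fun n => Multiplicative.ofAdd (hHat N (v n).left).x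
        map_one' := by rw [hv_one, SemidirectProduct.one_left, map_one, Heis.one_x, ofAdd_zero]
        map_mul' := fun a b => by
          rw [hv_mul, left_mul_of_right_eq_one p (hright a) _, map_mul, Heis.mul_x, ofAdd_add] }
  let Y₀ : ∀ N : ℕ+, ↥((ThetaSetting.modelχ' p).toOncePuncturedTemperedGroup e).deltaHat →* Multiplicative (ZMod N) :=
    fun N =>
      { toFun := fun n => Multiplicative.ofAdd (hHat N (v n).left).y
        map_one' := by rw [hv_one, SemidirectProduct.one_left, map_one, Heis.one_y, ofAdd_zero]
        map_mul' := fun a b => by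
          rw [hv_mul, left_mul_of_right_eq_one p (hright a) _, map_mul, Heis.mul_y, ofAdd_add] }
  have hX₀ : ∀ N n, X₀ N n = Multiplicative.ofAdd (hHat N (v n).left).x := fun _ _ => rfl
  have hY₀ : ∀ N n, Y₀ N n = Multiplicative.ofAdd (hHat N (v n).left).y := fun _ _ => rfl
  -- continuity of the coordinate homomorphisms (discrete codomain, `ĥ_N` and `left` continuous)
  have hvc : Continuous v := continuous_subtype_val
  have hleft : Continuous fun n => (v n).left := (continuous_fst.comp (continuous_leftRightHat p)).comp hvc
  have hX₀c : ∀ N, Continuous (X₀ N) := fun N =>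
    continuous_ofAdd.comp ((continuous_of_discreteTopology (f := fun h : Heis (ZMod N) => h.x)).comp
      ((hHat N).continuous.comp hleft))
  have hY₀c : ∀ N, Continuous (Y₀ N) := fun N =>
    continuous_ofAdd.comp ((continuous_of_discreteTopology (f := fun h : Heis (ZMod N) => h.y)).comp
      ((hHat N).continuous.comp hleft))
  -- they kill `[Δ̂, Δ̂]⁻`
  have hker : ∀ N, (((ThetaSetting.modelχ' p).toOncePuncturedTemperedGroup e).ellKerHat.subgroupOf
      ((ThetaSetting.modelχ' p).toOncePuncturedTemperedGroup e).deltaHat) ≤ (X₀ N).ker ⊓ (Y₀ N).ker := by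
    intro N n hn
    rw [Subgroup.mem_subgroupOf, ellKerHat_bridgeχ'] at hn
    change v n ∈ (⁅(curveχ p).DeltaHat, (curveχ p).DeltaHat⁆).topologicalClosure at hn
    rw [mem_closure_commutator_deltaHatχ_iff, mem_closure_commutator₂_iff_forall_hHat] at hn
    rw [Subgroup.mem_inf, MonoidHom.mem_ker, MonoidHom.mem_ker, hX₀, hY₀, (hn.1 N).1, (hn.1 N).2, ofAdd_zero]
    exact ⟨rfl, rfl⟩
  refine ⟨fun N => QuotientGroup.lift _ (X₀ N) ((hker N).trans inf_le_left),
    fun N => QuotientGroup.lift _ (Y₀ N) ((hker N).trans inf_le_right), ?_, ?_, ?_, ?_⟩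
  · intro N
    rw [← QuotientGroup.isOpenQuotientMap_mk.continuous_comp_iff]
    exact hX₀c N
  · intro N
    rw [← QuotientGroup.isOpenQuotientMap_mk.continuous_comp_iff]
    exact hY₀c N
  · intro N n hn
    rfl
  · intro N n hn
    rfl

/-! ### Properties of the level coordinates, read off their defining formulas -/

/-- Every element of `Δ^ell_X` of the bridge datum is the class of some `n ∈ F̂₂ ⋊_χ G_{ℚ_p}` with `n.right = 1`.
[cite: MochizukiEtTh2009, §1 p.12] -/
theorem exists_mk_eq_bridgeχ' (e : (ThetaSetting.modelχ' p).OncePuncturedData) (x : ((ThetaSetting.modelχ' p).toOncePuncturedTemperedGroup e).DeltaEll) :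
    ∃ (n : PiHtχ p) (hn : n ∈ ((ThetaSetting.modelχ' p).toOncePuncturedTemperedGroup e).deltaHat),
      n.right = 1 ∧ x = QuotientGroup.mk ⟨n, hn⟩ := by
  obtain ⟨m, rfl⟩ := QuotientGroup.mk_surjective x
  exact ⟨m.1, m.2, (mem_bridgeχ'_deltaHat_iff p e _).mp m.2, rfl⟩

/-- **Compatibility in `N`** of the `y`-levels: `Y_{NM} mod N = Y_N` (abc-iut-L2-t1's `map_hHat_of_dvd`).
[cite: MochizukiEtTh2009, §1 p.18] -/
theorem levelY_compat (e : (ThetaSetting.modelχ' p).OncePuncturedData)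
    (Y : ∀ N : ℕ+, ((ThetaSetting.modelχ' p).toOncePuncturedTemperedGroup e).DeltaEll →* Multiplicative (ZMod N))
    (hY : ∀ (N : ℕ+) (n : PiHtχ p) (hn : n ∈ ((ThetaSetting.modelχ' p).toOncePuncturedTemperedGroup e).deltaHat),
      Y N (QuotientGroup.mk ⟨n, hn⟩) = Multiplicative.ofAdd (hHat N n.left).y)
    (N M : ℕ+) (x : ((ThetaSetting.modelχ' p).toOncePuncturedTemperedGroup e).DeltaEll) :
    (ZMod.castHom (dvd_mul_right (N : ℕ) M) (ZMod N)) (Multiplicative.toAdd (Y (N * M) x)) =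
      Multiplicative.toAdd (Y N x) := by
  obtain ⟨n, hn, -, rfl⟩ := exists_mk_eq_bridgeχ' p e x
  rw [hY, hY]
  change (ZMod.castHom (dvd_mul_right (N : ℕ) M) (ZMod N)) (hHat (N * M) n.left).y = (hHat N n.left).y
  have h := map_hHat_of_dvd (M := N) (N := N * M) (dvd_mul_right (N : ℕ) M) n.left
  rw [← h, Heis.map_apply]
  rfl

/-- **Cyclotomic equivariance of the `y`-levels**: `Y_N (g · x) = χ_N(g.right) · Y_N x` for `g ∈ Γ ⋊_χ G_{ℚ_p}` —
conjugation by `ĝ = (γ, σ)` acts on the `left` component as `Inn(γ) ∘ θ_{χ(σ)}`, the inner part is invisible on the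
abelian coordinate `y`, and `θ_{χ(σ)}` multiplies `y` by `χ_N(σ)` (abc-iut-w5-d024's `hHat_twist`).
[cite: MochizukiEtTh2009, §1 p.12] -/
theorem levelY_conj (e : (ThetaSetting.modelχ' p).OncePuncturedData)
    (Y : ∀ N : ℕ+, ((ThetaSetting.modelχ' p).toOncePuncturedTemperedGroup e).DeltaEll →* Multiplicative (ZMod N))
    (hY : ∀ (N : ℕ+) (n : PiHtχ p) (hn : n ∈ ((ThetaSetting.modelχ' p).toOncePuncturedTemperedGroup e).deltaHat),
      Y N (QuotientGroup.mk ⟨n, hn⟩) = Multiplicative.ofAdd (hHat N n.left).y)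
    (N : ℕ+) (g : PiTpχ p) (x : ((ThetaSetting.modelχ' p).toOncePuncturedTemperedGroup e).DeltaEll) :
    Y N (((ThetaSetting.modelχ' p).toOncePuncturedTemperedGroup e).conjDeltaEll g x) = Y N x ^ (ZHatLevel.levelChar N (chi p g.right)).val := by
  obtain ⟨n, hn, hn1, rfl⟩ := exists_mk_eq_bridgeχ' p e x
  have hmem : toHatχ p g * n * (toHatχ p g)⁻¹ ∈ ((ThetaSetting.modelχ' p).toOncePuncturedTemperedGroup e).deltaHat := by
    rw [mem_bridgeχ'_deltaHat_iff, SemidirectProduct.mul_right, SemidirectProduct.mul_right, hn1, mul_one,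
      SemidirectProduct.inv_right, mul_inv_cancel]
  have hconj : ((ThetaSetting.modelχ' p).toOncePuncturedTemperedGroup e).conjDeltaHat g ⟨n, hn⟩ = ⟨toHatχ p g * n * (toHatχ p g)⁻¹, hmem⟩ :=
    Subtype.ext (((ThetaSetting.modelχ' p).toOncePuncturedTemperedGroup e).coe_conjDeltaHat g _)
  have hmap : ((ThetaSetting.modelχ' p).toOncePuncturedTemperedGroup e).conjDeltaEll g (QuotientGroup.mk ⟨n, hn⟩) =
      QuotientGroup.mk (((ThetaSetting.modelχ' p).toOncePuncturedTemperedGroup e).conjDeltaHat g ⟨n, hn⟩) := rfl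
  rw [hmap, hconj, hY, hY, left_conj_of_right_eq_one_hat p _ _ hn1, map_mul, map_mul, Heis.mul_y, Heis.mul_y,
    toHatχ_right, actHatχ_apply, hHat_twist, Heis.diagTwist_apply, map_inv, Heis.inv_y]
  set c : ZMod N := ZHatLevel.levelChar N (chi p g.right)
  have hring : (hHat N (toHatχ p g).left).y + c * (hHat N n.left).y + -(hHat N (toHatχ p g).left).y =
      c.val • (hHat N n.left).y := by
    rw [nsmul_eq_mul, ZMod.natCast_zmod_val]; ring
  rw [hring, ofAdd_nsmul]

/-- The `x`-levels are INVARIANT under conjugation (the twist fixes the `x`-coordinate).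
[cite: MochizukiEtTh2009, §1 p.12] -/
theorem levelX_conj (e : (ThetaSetting.modelχ' p).OncePuncturedData)
    (X : ∀ N : ℕ+, ((ThetaSetting.modelχ' p).toOncePuncturedTemperedGroup e).DeltaEll →* Multiplicative (ZMod N))
    (hX : ∀ (N : ℕ+) (n : PiHtχ p) (hn : n ∈ ((ThetaSetting.modelχ' p).toOncePuncturedTemperedGroup e).deltaHat),
      X N (QuotientGroup.mk ⟨n, hn⟩) = Multiplicative.ofAdd (hHat N n.left).x)
    (N : ℕ+) (g : PiTpχ p) (x : ((ThetaSetting.modelχ' p).toOncePuncturedTemperedGroup e).DeltaEll) :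
    X N (((ThetaSetting.modelχ' p).toOncePuncturedTemperedGroup e).conjDeltaEll g x) = X N x := by
  obtain ⟨n, hn, hn1, rfl⟩ := exists_mk_eq_bridgeχ' p e x
  have hmem : toHatχ p g * n * (toHatχ p g)⁻¹ ∈ ((ThetaSetting.modelχ' p).toOncePuncturedTemperedGroup e).deltaHat := by
    rw [mem_bridgeχ'_deltaHat_iff, SemidirectProduct.mul_right, SemidirectProduct.mul_right, hn1, mul_one,
      SemidirectProduct.inv_right, mul_inv_cancel]
  have hconj : ((ThetaSetting.modelχ' p).toOncePuncturedTemperedGroup e).conjDeltaHat g ⟨n, hn⟩ = ⟨toHatχ p g * n * (toHatχ p g)⁻¹, hmem⟩ :=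
    Subtype.ext (((ThetaSetting.modelχ' p).toOncePuncturedTemperedGroup e).coe_conjDeltaHat g _)
  have hmap : ((ThetaSetting.modelχ' p).toOncePuncturedTemperedGroup e).conjDeltaEll g (QuotientGroup.mk ⟨n, hn⟩) =
      QuotientGroup.mk (((ThetaSetting.modelχ' p).toOncePuncturedTemperedGroup e).conjDeltaHat g ⟨n, hn⟩) := rfl
  rw [hmap, hconj, hX, hX, left_conj_of_right_eq_one_hat p _ _ hn1, map_mul, map_mul, Heis.mul_x, Heis.mul_x,
    toHatχ_right, actHatχ_apply, hHat_twist, Heis.diagTwist_apply, map_inv, Heis.inv_x]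
  congr 1
  ring

/-- **The `x`-levels vanish on the image of `Δ^tp_Y`** (an element of `Γ = F̂₂ ×_Ẑ ℤ` of degree `pr₂ = 0` has
completed `a`-exponent `ê = 0`, and `x(ĥ_N) = ê mod N`). [cite: MochizukiEtTh2009, §1 p.12] -/
theorem levelX_eq_one_of_mem_piY (e : (ThetaSetting.modelχ' p).OncePuncturedData)
    (X : ∀ N : ℕ+, ((ThetaSetting.modelχ' p).toOncePuncturedTemperedGroup e).DeltaEll →* Multiplicative (ZMod N))
    (hX : ∀ (N : ℕ+) (n : PiHtχ p) (hn : n ∈ ((ThetaSetting.modelχ' p).toOncePuncturedTemperedGroup e).deltaHat),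
      X N (QuotientGroup.mk ⟨n, hn⟩) = Multiplicative.ofAdd (hHat N n.left).x)
    (N : ℕ+) (δ : ((ThetaSetting.modelχ' p).toOncePuncturedTemperedGroup e).delta)
    (hδ : (δ : ((ThetaSetting.modelχ' p).toOncePuncturedTemperedGroup e).Pi) ∈ ((ThetaSetting.modelχ' p).toOncePuncturedTemperedGroup e).piY) :
    X N (QuotientGroup.mk ⟨((ThetaSetting.modelχ' p).toOncePuncturedTemperedGroup e).toHat δ, Subgroup.le_topologicalClosure _ ⟨δ, δ.2, rfl⟩⟩) = 1 := by
  obtain ⟨g, hg, rfl⟩ : ∃ (g : PiTpχ p) (hg : g ∈ ((ThetaSetting.modelχ' p).toOncePuncturedTemperedGroup e).delta), δ = ⟨g, hg⟩ := ⟨δ.1, δ.2, rfl⟩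
  have hδ' : gfpSnd g.left = 1 := (mem_bridgeχ'_piY_iff p e g).mp hδ
  refine (hX N (toHatχ p g) _).trans ?_
  rw [hHat_x_eq_modN_eHat, toHatχ_left, gfpFst_apply, (mem_Gfp _).mp g.left.2, ← gfpSnd_apply, hδ', map_one,
    map_one]

/-- **The class of `b ∈ Δ^tp_Y` has `y`-level `1`** — so the `y`-levels are ONTO `ℤ/N` already on the image of
`Δ^tp_Y`. [cite: MochizukiEtTh2009, §1 p.12] -/
theorem levelY_b (e : (ThetaSetting.modelχ' p).OncePuncturedData)
    (Y : ∀ N : ℕ+, ((ThetaSetting.modelχ' p).toOncePuncturedTemperedGroup e).DeltaEll →* Multiplicative (ZMod N))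
    (hY : ∀ (N : ℕ+) (n : PiHtχ p) (hn : n ∈ ((ThetaSetting.modelχ' p).toOncePuncturedTemperedGroup e).deltaHat),
      Y N (QuotientGroup.mk ⟨n, hn⟩) = Multiplicative.ofAdd (hHat N n.left).y)
    (N : ℕ+) (hb : (SemidirectProduct.inl (bPowGfp (iotaZ (Multiplicative.ofAdd 1))) : PiTpχ p) ∈ ((ThetaSetting.modelχ' p).toOncePuncturedTemperedGroup e).delta) :
    Y N ((fun δ : ((ThetaSetting.modelχ' p).toOncePuncturedTemperedGroup e).delta =>
        (QuotientGroup.mk ⟨((ThetaSetting.modelχ' p).toOncePuncturedTemperedGroup e).toHat δ, Subgroup.le_topologicalClosure _ ⟨δ, δ.2, rfl⟩⟩ : ((ThetaSetting.modelχ' p).toOncePuncturedTemperedGroup e).DeltaEll))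
      ⟨(SemidirectProduct.inl (bPowGfp (iotaZ (Multiplicative.ofAdd 1))) : PiTpχ p), hb⟩) =
      Multiplicative.ofAdd 1 := by
  refine (hY N (toHatχ p (SemidirectProduct.inl (bPowGfp (iotaZ (Multiplicative.ofAdd 1))))) _).trans ?_
  rw [toHatχ_left, SemidirectProduct.left_inl, gfpFst_apply, coe_bPowGfp, bPow_iotaZ_one, hHat_eta, Heis.map_apply,
    heisHom_of_one]
  simp

/-- **Joint injectivity of the levels on `Δ^ell_X`**: an element all of whose `x`- and `y`-levels vanish is
trivial (its representative lies in `[F̂₂, F̂₂]⁻ ⋊ 1 = [Δ̂, Δ̂]⁻`, abc-iut-L2-d1's `mem_closure_commutator₂_iff_forall_hHat`).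
[cite: MochizukiEtTh2009, §1 p.12] -/
theorem eq_one_of_levels_eq_one (e : (ThetaSetting.modelχ' p).OncePuncturedData)
    (X : ∀ N : ℕ+, ((ThetaSetting.modelχ' p).toOncePuncturedTemperedGroup e).DeltaEll →* Multiplicative (ZMod N))
    (hX : ∀ (N : ℕ+) (n : PiHtχ p) (hn : n ∈ ((ThetaSetting.modelχ' p).toOncePuncturedTemperedGroup e).deltaHat),
      X N (QuotientGroup.mk ⟨n, hn⟩) = Multiplicative.ofAdd (hHat N n.left).x)
    (Y : ∀ N : ℕ+, ((ThetaSetting.modelχ' p).toOncePuncturedTemperedGroup e).DeltaEll →* Multiplicative (ZMod N))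
    (hY : ∀ (N : ℕ+) (n : PiHtχ p) (hn : n ∈ ((ThetaSetting.modelχ' p).toOncePuncturedTemperedGroup e).deltaHat),
      Y N (QuotientGroup.mk ⟨n, hn⟩) = Multiplicative.ofAdd (hHat N n.left).y)
    (x : ((ThetaSetting.modelχ' p).toOncePuncturedTemperedGroup e).DeltaEll) (h : ∀ N : ℕ+, X N x = 1 ∧ Y N x = 1) : x = 1 := by
  obtain ⟨n, hn, hn1, rfl⟩ := exists_mk_eq_bridgeχ' p e x
  rw [QuotientGroup.eq_one_iff, Subgroup.mem_subgroupOf, ellKerHat_bridgeχ']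
  change n ∈ (⁅(curveχ p).DeltaHat, (curveχ p).DeltaHat⁆).topologicalClosure
  rw [mem_closure_commutator_deltaHatχ_iff, mem_closure_commutator₂_iff_forall_hHat]
  refine ⟨fun N => ?_, hn1⟩
  have hNx := (h N).1
  have hNy := (h N).2
  rw [hX, ofAdd_eq_one] at hNx
  rw [hY, ofAdd_eq_one] at hNy
  exact ⟨hNx, hNy⟩

end Literature.AnabelianGeometry.EtaleTheta.SettingModel

end
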